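import Literature.MathematicalPhysics.QuantumFieldTheory.BalabanImbrieJaffe1984to88.BIJ88ConnectedGraphFilling
import Literature.MathematicalPhysics.QuantumFieldTheory.BalabanImbrieJaffe1984to88.BIJ88ConnectedGraphTreeBound

/-!
# `BalabanImbrieJaffe1984to88.BIJ88ConnectedGraphFillingBound` — T. Bałaban, J. Imbrie, A. Jaffe, *Effective action and cluster properties of
the abelian Higgs model*, Commun. Math. Phys. **114** (1988) 257–315 [BalabanImbrieJaffe1988], Sect. 5.14, p. 310 [PDF 54]: *"It is now a standard
exercise to estimate the expansion, using (5.14.4). The result is |W₆^{(k)′}(X)| ≤ (e^β(L^kε/ε₀)^{1/4−α})^{n̄+1+β′|X|}."* — **THE "FILL X" PIECES OF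
THE CONNECTED-GRAPH SUMS ARE BOUNDED WITH A DECAY `q^{|X|}`, IN ANY BOOKKEEPING** (the estimate half of `BIJ88ConnectedGraphFilling`; the mechanism of
the `|X|`-dependence of the printed "result": the clusters of a family filling `X` carry `Σ_i |U Z_i| ≥ |X|` units of the per-cube smallness).

statement-level skeleton of published theorems with citation tags; proofs where landed; nothing here is a claim about the Yang–Mills mass gap

PDF held: `paper:balaban1988-cmp114-bij-abelian-higgs-effective-action` (journal page = PDF page + 256); p. 310 = PDF 54 (`p0054.txt` L25–27) read
this generation.

WHAT IS REPRODUCED (unit `lit-balaban-p36`, generation 13 of the Phase-2 proof seat p36, file 3 of the display-4 chain; SKELETON row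
**C2.Claim@310** (the *"standard exercise … The result is"* sentence, member) of `HOME/lit-balaban-r16/ROWS-C2-part2.md`; owner r16, head
untouched; HOME `run/shared/lean/pub/lit-balaban/`).  Setting of `BIJ88ConnectedGraphFilling` (sites `V`, slots `S`, family `Q`, `loc`, activity
`w`, cube projection `U : Finset V → Finset κ`; `TrawFill`/`TordFill`/`TsumFill`).  Theorems only (0 definitions):
* **`abs_TrawFill_le_of_actBound`** — steps (a)–(c): an activity bound `|w(H, Z)| ≤ M^{|H|}·u(Z)·q^{|U Z|}` on `Q` (`M, u ≥ 0`, `0 ≤ q ≤ 1`)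
  gives `|TrawFill_m(X; b)| ≤ q^{|X|}·M^{|b|}·|b|!·Σ_{Z ∈ (Q|_X)^m} |ρ^T(Z)|·Π_i e·u(Z_i)` (`Q|_X` = the clusters with cubes in `X`; the labelled
  structures number `≤ m^{|b|} ≤ |b|!·e^m`, p36 g11 `BIJ88ConnectedGraphTreeBound.card_filter_owp_le`);
* **`sum_abs_TordFill_le_of_treeHyp`**, `summable_norm_TordFill_of_treeHyp`, **`abs_TsumFill_le_of_treeHyp`** — step (d): under Dimock's
  tree-graph hypotheses for the weight `e·u` and a volume `vol ≥ 0` on the sub-family `Q|_X` (vertex constant `A ≤ 1/8`, root constant `B`;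
  engine `Dimock2011to13.TreeGraphSummation.hstar_partialSum_le`): `Σ_{m<N} |TordFill_m(X; b)| ≤ q^{|X|}·M^{|b|}·|b|!·2AB`, the series converges
  absolutely, `|TsumFill(X; b)| ≤ q^{|X|}·M^{|b|}·|b|!·2AB`.
HONEST SCOPE: finite combinatorics and absolutely convergent real series; constants not optimized; (5.14.4) is not used here (it enters in the
virtual-support instantiation, sibling `BIJ88W6PrimeVsupp`).  0 `sorry`, 0 definitions, 0 `Prop` facts (D-0026); imports `BIJ88ConnectedGraphFilling`
(p36 g13) and `BIJ88ConnectedGraphTreeBound` (p36 g11); modifies nothing.  NOT summit progress; NOT continuum; NOT Clay.  Cell `lit-balaban` Phase 2,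
seat p36 gen 13 (row owner r16, referee ref-5).
-/

noncomputable section

namespace Literature.MathematicalPhysics.QuantumFieldTheory.BalabanImbrieJaffe1984to88.BIJ88ConnectedGraphFillingBound

open Finset
open Literature.MathematicalPhysics.QuantumFieldTheory.Dimock2011to13.UrsellTreeGraphBound (rhoT)
open Literature.MathematicalPhysics.QuantumFieldTheory.Dimock2011to13.TreeGraphSummation (hstar_partialSum_le)
open BIJ88ConnectedGraphResummation (OWP InQ Cov wprod Traw Tord Tsum Tord_zero exists_carrier)
open BIJ88ConnectedGraphTreeBound (piFinset_eq_filter_inQ card_filter_owp_le abs_wprod_le)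
open BIJ88ConnectedGraphFilling (TrawFill TordFill TsumFill TrawFill_eq_filter Traw_eq_sum_TrawFill)

variable {V : Type*} {S : Type*} {κ : Type*} [DecidableEq V] [Fintype V] [DecidableEq S] [Fintype S] [DecidableEq κ]
  {Q : Finset (Finset V)} {loc : S → V} {w : Finset S → Finset V → ℝ} {U : Finset V → Finset κ}

/-! ## §6 The standard exercise with `|X|`-decay: the filling clusters carry `Σ_i |U Z_i| ≥ |X|` -/

/-- **STEPS (a)–(c) WITH `|X|`-DECAY**: an activity bound `|w(H, Z)| ≤ M^{|H|}·u(Z)·q^{|U Z|}` on `Q` (`M, u ≥ 0`, `0 ≤ q ≤ 1`) gives, for the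
`X`-piece with `m` clusters, `|TrawFill_m(X; b)| ≤ q^{|X|}·M^{|b|}·|b|!·Σ_{Z ∈ (Q|_X)^m} |ρ^T(Z)|·Π_i e·u(Z_i)` — the families filling `X` have
`Σ_i |U Z_i| ≥ |⋃_i U Z_i| = |X|`, the labelled structures number `≤ m^{|b|} ≤ |b|!·e^m`. [cite: BalabanImbrieJaffe1988, p.310 (Sect. 5.14)] -/
theorem abs_TrawFill_le_of_actBound {u : Finset V → ℝ} {M q : ℝ} (hM : 0 ≤ M) (hu : ∀ Z, 0 ≤ u Z) (hq0 : 0 ≤ q) (hq1 : q ≤ 1)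
    (hw : ∀ H : Finset S, ∀ Z ∈ Q, |w H Z| ≤ M ^ H.card * (u Z * q ^ (U Z).card)) (X : Finset κ) (b : Finset S) (m : ℕ) :
    |TrawFill Q loc w U X (Fin m) b| ≤ q ^ X.card * (M ^ b.card * b.card.factorial *
      ∑ Z ∈ Fintype.piFinset (fun _ : Fin m => Q.filter fun Z => U Z ⊆ X), |(rhoT Z univ : ℝ)| * ∏ i, (Real.exp 1 * u (Z i))) := by
  classical
  rw [TrawFill_eq_filter]
  set Q' : Finset (Finset V) := Q.filter fun Z => U Z ⊆ X with hQ'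
  have hw' : ∀ H : Finset S, ∀ Z ∈ Q', |w H Z| ≤ M ^ H.card * (u Z * q ^ (U Z).card) :=
    fun H Z hZ => hw H Z (mem_filter.1 hZ).1
  have hB0 : ∀ Z : Fin m → Finset V, 0 ≤ q ^ X.card * (M ^ b.card * (|(rhoT Z univ : ℝ)| * ∏ i, u (Z i))) :=
    fun Z => mul_nonneg (pow_nonneg hq0 _) (mul_nonneg (pow_nonneg hM _) (mul_nonneg (abs_nonneg _) (prod_nonneg fun i _ => hu _)))
  -- (1) one labelled family, with the decay factor extracted from the filling condition
  have hfam : ∀ (Hs : Fin m → Finset S) (Z : Fin m → Finset V),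
      |(if OWP b Hs ∧ InQ Q' Z ∧ Cov loc Hs Z ∧ univ.biUnion (fun i => U (Z i)) = X then (rhoT Z univ : ℝ) * wprod w Hs Z else 0)| ≤
        (if InQ Q' Z then 1 else 0) * ((if OWP b Hs then 1 else 0) *
          (q ^ X.card * (M ^ b.card * (|(rhoT Z univ : ℝ)| * ∏ i, u (Z i))))) := by
    intro Hs Z
    by_cases h : OWP b Hs ∧ InQ Q' Z ∧ Cov loc Hs Z ∧ univ.biUnion (fun i => U (Z i)) = X
    · obtain ⟨howp, hQ, hcov, hfill⟩ := h
      rw [if_pos ⟨howp, hQ, hcov, hfill⟩, if_pos hQ, if_pos howp, one_mul, one_mul, abs_mul]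
      have hwp := abs_wprod_le (Q := Q') (u := fun Z => u Z * q ^ (U Z).card) hw' howp hQ
      have hcardX : X.card ≤ ∑ i, (U (Z i)).card := hfill ▸ card_biUnion_le
      have hqX : q ^ (∑ i, (U (Z i)).card) ≤ q ^ X.card := pow_le_pow_of_le_one hq0 hq1 hcardX
      have hsplit : (∏ i, (u (Z i) * q ^ (U (Z i)).card)) = (∏ i, u (Z i)) * q ^ (∑ i, (U (Z i)).card) := by
        rw [prod_mul_distrib, prod_pow_eq_pow_sum]
      have hprod0 : 0 ≤ ∏ i, u (Z i) := prod_nonneg fun i _ => hu _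
      calc |(rhoT Z univ : ℝ)| * |wprod w Hs Z| ≤ |(rhoT Z univ : ℝ)| * (M ^ b.card * ∏ i, (u (Z i) * q ^ (U (Z i)).card)) :=
            mul_le_mul_of_nonneg_left hwp (abs_nonneg _)
        _ = |(rhoT Z univ : ℝ)| * (M ^ b.card * ((∏ i, u (Z i)) * q ^ (∑ i, (U (Z i)).card))) := by rw [hsplit]
        _ ≤ |(rhoT Z univ : ℝ)| * (M ^ b.card * ((∏ i, u (Z i)) * q ^ X.card)) := by gcongr
        _ = q ^ X.card * (M ^ b.card * (|(rhoT Z univ : ℝ)| * ∏ i, u (Z i))) := by ring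
    · rw [if_neg h, abs_zero]
      exact mul_nonneg (by split_ifs <;> norm_num) (mul_nonneg (by split_ifs <;> norm_num) (hB0 Z))
  -- (2) the count of the labelled structures, (3) the tuples
  have hcount : (((univ : Finset (Fin m → Finset S)).filter fun Hs => OWP b Hs).card : ℝ) ≤
      b.card.factorial * Real.exp m := by
    have h := Real.pow_div_factorial_le_exp (x := (m : ℝ)) (Nat.cast_nonneg m) b.card
    rw [div_le_iff₀ (by positivity)] at h
    calc (((univ : Finset (Fin m → Finset S)).filter fun Hs => OWP b Hs).card : ℝ) ≤ (m : ℝ) ^ b.card := by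
          exact_mod_cast card_filter_owp_le b m
      _ ≤ Real.exp m * b.card.factorial := h
      _ = b.card.factorial * Real.exp m := mul_comm _ _
  unfold TrawFill
  calc |∑ Hs : Fin m → Finset S, ∑ Z : Fin m → Finset V,
          (if OWP b Hs ∧ InQ Q' Z ∧ Cov loc Hs Z ∧ univ.biUnion (fun i => U (Z i)) = X then (rhoT Z univ : ℝ) * wprod w Hs Z else 0)|
      ≤ ∑ Hs : Fin m → Finset S, |∑ Z : Fin m → Finset V,
          (if OWP b Hs ∧ InQ Q' Z ∧ Cov loc Hs Z ∧ univ.biUnion (fun i => U (Z i)) = X then (rhoT Z univ : ℝ) * wprod w Hs Z else 0)| :=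
        abs_sum_le_sum_abs _ _
    _ ≤ ∑ Hs : Fin m → Finset S, ∑ Z : Fin m → Finset V,
          |(if OWP b Hs ∧ InQ Q' Z ∧ Cov loc Hs Z ∧ univ.biUnion (fun i => U (Z i)) = X then (rhoT Z univ : ℝ) * wprod w Hs Z else 0)| :=
        sum_le_sum fun Hs _ => abs_sum_le_sum_abs _ _
    _ = ∑ Z : Fin m → Finset V, ∑ Hs : Fin m → Finset S,
          |(if OWP b Hs ∧ InQ Q' Z ∧ Cov loc Hs Z ∧ univ.biUnion (fun i => U (Z i)) = X then (rhoT Z univ : ℝ) * wprod w Hs Z else 0)| :=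
        sum_comm
    _ ≤ ∑ Z : Fin m → Finset V, ∑ Hs : Fin m → Finset S,
          (if InQ Q' Z then 1 else 0) * ((if OWP b Hs then 1 else 0) *
            (q ^ X.card * (M ^ b.card * (|(rhoT Z univ : ℝ)| * ∏ i, u (Z i))))) :=
        sum_le_sum fun Z _ => sum_le_sum fun Hs _ => hfam Hs Z
    _ = ∑ Z : Fin m → Finset V, (if InQ Q' Z then 1 else 0) *
          ((((univ : Finset (Fin m → Finset S)).filter fun Hs => OWP b Hs).card : ℝ) *
            (q ^ X.card * (M ^ b.card * (|(rhoT Z univ : ℝ)| * ∏ i, u (Z i))))) := by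
        refine sum_congr rfl fun Z _ => ?_
        rw [← mul_sum, ← sum_mul, ← sum_filter, sum_const, nsmul_eq_mul, mul_one]
    _ ≤ ∑ Z : Fin m → Finset V, (if InQ Q' Z then 1 else 0) *
          ((b.card.factorial * Real.exp m) * (q ^ X.card * (M ^ b.card * (|(rhoT Z univ : ℝ)| * ∏ i, u (Z i))))) :=
        sum_le_sum fun Z _ => mul_le_mul_of_nonneg_left (mul_le_mul_of_nonneg_right hcount (hB0 Z))
          (by split_ifs <;> norm_num)
    _ = ∑ Z ∈ Fintype.piFinset (fun _ : Fin m => Q'),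
          (b.card.factorial * Real.exp m) * (q ^ X.card * (M ^ b.card * (|(rhoT Z univ : ℝ)| * ∏ i, u (Z i)))) := by
        rw [piFinset_eq_filter_inQ, sum_filter]
        refine sum_congr rfl fun Z _ => ?_
        split_ifs <;> simp
    _ = q ^ X.card * (M ^ b.card * b.card.factorial *
          ∑ Z ∈ Fintype.piFinset (fun _ : Fin m => Q'), |(rhoT Z univ : ℝ)| * ∏ i, (Real.exp 1 * u (Z i))) := by
        rw [mul_sum, mul_sum]
        refine sum_congr rfl fun Z _ => ?_
        rw [prod_mul_distrib, prod_const, card_univ, Fintype.card_fin, Real.exp_one_pow]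
        ring

/-- **STEP (d) WITH `|X|`-DECAY — THE SHAPE OF THE PRINTED "RESULT"**: with the activity bound of `abs_TrawFill_le_of_actBound` and Dimock's
tree-graph hypotheses for the weight `e·u` and a volume `vol ≥ 0` ON THE SUB-FAMILY `Q|_X` (vertex constant `A ≤ 1/8`, root constant `B`), every
partial sum of `Σ_m |TordFill_m(X; b)|`, `b ≠ ∅`, is at most `q^{|X|}·M^{|b|}·|b|!·2AB`. [cite: BalabanImbrieJaffe1988, p.310 (Sect. 5.14)] -/
theorem sum_abs_TordFill_le_of_treeHyp {u vol : Finset V → ℝ} {M q A B : ℝ} (hM : 0 ≤ M) (hu : ∀ Z, 0 ≤ u Z) (hq0 : 0 ≤ q)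
    (hq1 : q ≤ 1) (hw : ∀ H : Finset S, ∀ Z ∈ Q, |w H Z| ≤ M ^ H.card * (u Z * q ^ (U Z).card)) (X : Finset κ)
    (hvol : ∀ Z ∈ Q.filter (fun Z => U Z ⊆ X), 0 ≤ vol Z) (hA : 0 ≤ A) (hB : 0 ≤ B) (hA8 : A ≤ 1 / 8)
    (H1 : ∀ X' ∈ Q.filter (fun Z => U Z ⊆ X), ∀ k : ℕ,
      ∑ Z ∈ Q.filter (fun Z => U Z ⊆ X) with ¬ Disjoint Z X', Real.exp 1 * u Z * vol Z ^ k ≤ k.factorial * A * vol X')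
    (H0 : ∀ k : ℕ, ∑ Z ∈ Q.filter (fun Z => U Z ⊆ X), Real.exp 1 * u Z * vol Z ^ k ≤ k.factorial * A * B)
    {b : Finset S} (hb : b.Nonempty) (N : ℕ) :
    ∑ m ∈ range N, |TordFill Q loc w U X m b| ≤ q ^ X.card * (M ^ b.card * b.card.factorial * (2 * A * B)) := by
  have hC0 : 0 ≤ q ^ X.card * (M ^ b.card * (b.card.factorial : ℝ)) := by positivity
  have hrhs : 0 ≤ q ^ X.card * (M ^ b.card * b.card.factorial * (2 * A * B)) := by positivity
  cases N with
  | zero => simpa using hrhs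
  | succ N =>
    have h0 : TordFill Q loc w U X 0 b = 0 := by
      have hz : Tord Q loc w 0 b = 0 := Tord_zero _ _ _ hb
      unfold TordFill
      unfold Tord at hz
      rw [Nat.factorial_zero, Nat.cast_one, div_one] at hz ⊢
      rw [TrawFill_eq_filter]
      have hz' : Traw (Q.filter fun Z => U Z ⊆ X) loc w (Fin 0) b = 0 := by
        have := Tord_zero (Q.filter fun Z => U Z ⊆ X) loc w hb
        unfold Tord at this
        rwa [Nat.factorial_zero, Nat.cast_one, div_one] at this
      rw [Traw_eq_sum_TrawFill (Q.filter fun Z => U Z ⊆ X) loc w U (W := X) (fun Z hZ => (mem_filter.1 hZ).2)] at hz'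
      -- every `X'`-piece with no cluster vanishes unless `X' = ∅`; all pieces are the `∅`-family sum, which is `0` for `b ≠ ∅`
      have hall : ∀ X' ∈ X.powerset, TrawFill (Q.filter fun Z => U Z ⊆ X) loc w U X' (Fin 0) b = 0 := by
        intro X' _
        unfold TrawFill
        refine sum_eq_zero fun Hs _ => sum_eq_zero fun Z _ => if_neg ?_
        rintro ⟨howp, -, -, -⟩
        obtain ⟨j, hj⟩ := hb
        obtain ⟨i, -⟩ := exists_carrier howp hj
        exact Fin.elim0 i
      by_cases hX : X ∈ X.powerset
      · exact (TrawFill_eq_filter Q loc w U X (Fin 0) b).symm ▸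
          (TrawFill_eq_filter Q loc w U X (Fin 0) b ▸ hall X hX)
      · exact absurd (mem_powerset.2 Subset.rfl) hX
    rw [sum_range_succ', h0, abs_zero, add_zero]
    calc ∑ n ∈ range N, |TordFill Q loc w U X (n + 1) b|
        = ∑ n ∈ range N, (1 / ((n + 1).factorial : ℝ)) * |TrawFill Q loc w U X (Fin (n + 1)) b| := by
          refine sum_congr rfl fun n _ => ?_
          unfold TordFill
          rw [abs_div, Nat.abs_cast, div_eq_mul_one_div, mul_comm]
      _ ≤ ∑ n ∈ range N, (1 / ((n + 1).factorial : ℝ)) * (q ^ X.card * (M ^ b.card * b.card.factorial *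
            ∑ Z ∈ Fintype.piFinset (fun _ : Fin (n + 1) => Q.filter fun Z => U Z ⊆ X),
              |(rhoT Z univ : ℝ)| * ∏ i, (Real.exp 1 * u (Z i)))) :=
          sum_le_sum fun n _ => mul_le_mul_of_nonneg_left (abs_TrawFill_le_of_actBound hM hu hq0 hq1 hw X b (n + 1)) (by positivity)
      _ = q ^ X.card * (M ^ b.card * b.card.factorial) * ∑ n ∈ range N, ((1 / ((n + 1).factorial : ℝ)) *
            ∑ Z ∈ Fintype.piFinset (fun _ : Fin (n + 1) => Q.filter fun Z => U Z ⊆ X),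
              |(rhoT Z univ : ℝ)| * ∏ i, (Real.exp 1 * u (Z i))) := by
          rw [mul_sum]
          exact sum_congr rfl fun n _ => by ring
      _ ≤ q ^ X.card * (M ^ b.card * b.card.factorial) * (2 * A * B) :=
          mul_le_mul_of_nonneg_left (hstar_partialSum_le (w := fun Z => Real.exp 1 * u Z)
            (fun Z _ => mul_nonneg (Real.exp_nonneg 1) (hu Z)) hvol hA hB hA8 H1 H0 N) hC0
      _ = q ^ X.card * (M ^ b.card * b.card.factorial * (2 * A * B)) := by ring

/-- **… hence the series of the `X`-piece converges absolutely.** [cite: BalabanImbrieJaffe1988, p.310 (Sect. 5.14)] -/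
theorem summable_norm_TordFill_of_treeHyp {u vol : Finset V → ℝ} {M q A B : ℝ} (hM : 0 ≤ M) (hu : ∀ Z, 0 ≤ u Z) (hq0 : 0 ≤ q)
    (hq1 : q ≤ 1) (hw : ∀ H : Finset S, ∀ Z ∈ Q, |w H Z| ≤ M ^ H.card * (u Z * q ^ (U Z).card)) (X : Finset κ)
    (hvol : ∀ Z ∈ Q.filter (fun Z => U Z ⊆ X), 0 ≤ vol Z) (hA : 0 ≤ A) (hB : 0 ≤ B) (hA8 : A ≤ 1 / 8)
    (H1 : ∀ X' ∈ Q.filter (fun Z => U Z ⊆ X), ∀ k : ℕ,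
      ∑ Z ∈ Q.filter (fun Z => U Z ⊆ X) with ¬ Disjoint Z X', Real.exp 1 * u Z * vol Z ^ k ≤ k.factorial * A * vol X')
    (H0 : ∀ k : ℕ, ∑ Z ∈ Q.filter (fun Z => U Z ⊆ X), Real.exp 1 * u Z * vol Z ^ k ≤ k.factorial * A * B)
    {b : Finset S} (hb : b.Nonempty) : Summable fun m => ‖TordFill Q loc w U X m b‖ := by
  have h := summable_of_sum_range_le (fun _ => abs_nonneg _)
    (sum_abs_TordFill_le_of_treeHyp (loc := loc) hM hu hq0 hq1 hw X hvol hA hB hA8 H1 H0 hb)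
  simpa only [Real.norm_eq_abs] using h

/-- **… and the `X`-piece of the truncated function is bounded WITH THE DECAY `q^{|X|}`**: `|TsumFill(X; b)| ≤ q^{|X|}·M^{|b|}·|b|!·2AB`.
[cite: BalabanImbrieJaffe1988, p.310 (Sect. 5.14)] -/
theorem abs_TsumFill_le_of_treeHyp {u vol : Finset V → ℝ} {M q A B : ℝ} (hM : 0 ≤ M) (hu : ∀ Z, 0 ≤ u Z) (hq0 : 0 ≤ q)
    (hq1 : q ≤ 1) (hw : ∀ H : Finset S, ∀ Z ∈ Q, |w H Z| ≤ M ^ H.card * (u Z * q ^ (U Z).card)) (X : Finset κ)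
    (hvol : ∀ Z ∈ Q.filter (fun Z => U Z ⊆ X), 0 ≤ vol Z) (hA : 0 ≤ A) (hB : 0 ≤ B) (hA8 : A ≤ 1 / 8)
    (H1 : ∀ X' ∈ Q.filter (fun Z => U Z ⊆ X), ∀ k : ℕ,
      ∑ Z ∈ Q.filter (fun Z => U Z ⊆ X) with ¬ Disjoint Z X', Real.exp 1 * u Z * vol Z ^ k ≤ k.factorial * A * vol X')
    (H0 : ∀ k : ℕ, ∑ Z ∈ Q.filter (fun Z => U Z ⊆ X), Real.exp 1 * u Z * vol Z ^ k ≤ k.factorial * A * B)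
    {b : Finset S} (hb : b.Nonempty) :
    |TsumFill Q loc w U X b| ≤ q ^ X.card * (M ^ b.card * b.card.factorial * (2 * A * B)) := by
  have hle := sum_abs_TordFill_le_of_treeHyp (loc := loc) hM hu hq0 hq1 hw X hvol hA hB hA8 H1 H0 hb
  have hs : Summable fun m => ‖TordFill Q loc w U X m b‖ :=
    summable_norm_TordFill_of_treeHyp hM hu hq0 hq1 hw X hvol hA hB hA8 H1 H0 hb
  calc |TsumFill Q loc w U X b| = ‖∑' m, TordFill Q loc w U X m b‖ := (Real.norm_eq_abs _).symm
    _ ≤ ∑' m, ‖TordFill Q loc w U X m b‖ := norm_tsum_le_tsum_norm hs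
    _ ≤ q ^ X.card * (M ^ b.card * b.card.factorial * (2 * A * B)) :=
        Real.tsum_le_of_sum_range_le (fun _ => norm_nonneg _) fun N => by simpa only [Real.norm_eq_abs] using hle N

end Literature.MathematicalPhysics.QuantumFieldTheory.BalabanImbrieJaffe1984to88.BIJ88ConnectedGraphFillingBound

end
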